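import Literature.AlgebraicGeometry.Resolution.MuPTorsorLocalUniformization
import Literature.AlgebraicGeometry.CossartPiltant200819.LocalModels2008
import Literature.AlgebraicGeometry.Resolution.RegularLocalRingsNormal
import HarnessLib

/-!
# Temkin's `μ_p`-torsor reduction of local uniformization over F-finite ground fields

Source: M. Temkin, *Inseparable local uniformization*, J. Algebra 373 (2013) 65–119,
arXiv:0804.1554 (v3); bib key `Temkin2013`. Reproduced here: Remark 1.3.5 (ii) (= Remark 1.5 (ii)
of arXiv v3, p. 4) AS PRINTED, i.e. over ground fields `k` with `[k : k^p] < ∞`: "Assume that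
[k:k^p] is finite. Then there exists a tower K = K_m ⊃ … ⊃ L^{p^n} = K_0 such that each
K_i = K_{i-1}(a_i^{1/p}) is purely inseparable of degree p over K_{i-1}. … If we know how to
uniformize valuations on μ_p-torsors over regular schemes, then we can uniformize K°_1, and
proceeding inductively to K°_2, etc., we would uniformize the original K°."
`MuPTorsorLocalUniformization.lean` formalises the remark over PERFECT ground fields (where
`k^{p^n} = k`); this file removes that restriction up to F-finiteness, which is exactly the
hypothesis of the printed remark.

What is different in the F-finite case, and how it is handled:
* the Frobenius image `K₀ = L^{p^n} ⊆ K` of Temkin's inseparable model `L ⊇ K` is of finite type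
  over `k^{p^n}`, NOT over `k`; so the whole tower is climbed over the ground field `k^{p^n} ≅ k`
  (`baseFrobImage`, `baseFrobImageEquiv`; transport `IsLocallyUniformizable.of_ringEquiv₂` along
  the Frobenius isomorphism `L ≅ L^{p^n}` OVER the isomorphism of ground fields `k ≅ k^{p^n}`);
* the tower `K₀ ⊆ … ⊆ K` must also adjoin `p^n`-th roots generating `k` over `k^{p^n}`; finitely
  many suffice because `k` is F-finite (`FrobeniusFinite`, `FrobeniusFinite.iterate`);
* at the top, a `k^{p^n}`-model of `O` regular at the centre is turned into a `k`-model with the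
  same local ring (`IsLocallyUniformizable.of_subfield_base`: regular ⇒ normal ⇒ the local ring
  contains `k`, which is integral over `k^{p^n}` and lies in `O`) — the step the source leaves
  implicit when it calls `X_0 = Spec(A_0)` a model.

Main results:
* `isLocallyUniformizable_of_muPTorsorStepsAt_ffinite` — pointwise form: `Temkin2013`, `k`
  F-finite, torsor steps at `O` over each `k^{p^n} ⊆ K` ⟹ `O` is locally uniformizable over `k`;
* `localUniformizationFFiniteInChar_iff` —
  `Temkin2013 → (LocalUniformizationFFiniteInChar p ↔ MuPTorsorLocalUniformizationFFinite p)`;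
* `MuPTorsorLocalUniformizationInChar.localUniformizationFFinite` — the torsor problem over all
  ground fields of characteristic `p` gives local uniformization over all F-finite ones.

Not reproduced: ground fields with `[k : k^p] = ∞`. There the remark does not apply as stated
(`k` is not finitely generated over `k^{p^n}`; the source only records the weaker 1.3.5 (i)), and
the natural substitute goes through the `l`-smooth form of Theorem 1.3.2, which the tree's
`Temkin2013` does not carry.
-/

noncomputable section

open IsLocalRing

namespace Literature.AlgebraicGeometry.Resolution

universe u

/-! ## Transport along a semilinear isomorphism with two ground fields -/

/-- **Transport of an affine model along a semilinear isomorphism of fields over an isomorphism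
of ground fields.** Let `e : L ≃ M` be a ring isomorphism, `σ : k ≃ k'` an isomorphism of ground
fields with `e (c • x) = σ c • e x`, and `O` a valuation ring of `M`. If `e⁻¹ O` is locally
uniformizable over `k`, then `O` is locally uniformizable over `k'`.
(`IsLocallyUniformizable.of_ringEquiv` is the case `k = k'`.) [folklore] -/
theorem IsLocallyUniformizable.of_ringEquiv₂ {k k' L M : Type u} [Field k] [Field k'] [Field L]
    [Field M] [Algebra k L] [Algebra k' M] (e : L ≃+* M) (σ : k ≃+* k')
    (he : ∀ c : k, e (algebraMap k L c) = algebraMap k' M (σ c)) (O : ValuationSubring M)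
    (h : IsLocallyUniformizable k L (O.comap (e : L →+* M))) :
    IsLocallyUniformizable k' M O := by
  classical
  obtain ⟨A, hA, ⟨s, hs⟩, hfrac, hreg⟩ := h
  -- the image model `A₀ = e(A) = k'[e(s)]`
  let s₀ : Finset M := s.image e
  let A₀ : Subalgebra k' M := Algebra.adjoin k' (s₀ : Set M)
  have hA₀fg : A₀.FG := Subalgebra.fg_adjoin_finset s₀
  have hrange : (e : L →+* M) '' Set.range (algebraMap k L) = Set.range (algebraMap k' M) := by
    ext x
    constructor
    · rintro ⟨_, ⟨c, rfl⟩, rfl⟩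
      exact ⟨σ c, by rw [RingEquiv.coe_toRingHom, he]⟩
    · rintro ⟨c, rfl⟩
      exact ⟨algebraMap k L (σ.symm c), ⟨_, rfl⟩, by
        rw [RingEquiv.coe_toRingHom, he, RingEquiv.apply_symm_apply]⟩
  have hmapS : A.toSubring.map (e : L →+* M) = A₀.toSubring := by
    rw [← hs, Algebra.adjoin_eq_ring_closure, Algebra.adjoin_eq_ring_closure, RingHom.map_closure,
      Set.image_union, hrange]
    congr 2
    rw [Finset.coe_image, RingEquiv.coe_toRingHom]
  have hmemA₀ : ∀ {a : L}, a ∈ A → e a ∈ A₀ := by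
    intro a ha
    have : e a ∈ A.toSubring.map (e : L →+* M) := Subring.mem_map.mpr ⟨a, ha, rfl⟩
    rw [hmapS] at this
    exact this
  have hA₀O : A₀.toSubring ≤ O.toSubring := by
    intro x hx
    have hx' : x ∈ A.toSubring.map (e : L →+* M) := by rw [hmapS]; exact hx
    obtain ⟨a, ha, rfl⟩ := Subring.mem_map.mp hx'
    exact hA ha
  haveI := hfrac
  have hA₀fr : IsFractionRing A₀ M := by
    refine IsFractionRing.of_field A₀ M fun z => ?_
    obtain ⟨a, b, -, hab⟩ := IsFractionRing.div_surjective (A := A) (e.symm z)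
    refine ⟨⟨e a, hmemA₀ a.2⟩, ⟨e b, hmemA₀ b.2⟩, ?_⟩
    show z = e a / e b
    have hab' : (a : L) / b = e.symm z := hab
    rw [← map_div₀, hab', RingEquiv.apply_symm_apply]
  refine ⟨A₀, hA₀O, hA₀fg, hA₀fr, ?_⟩
  -- transport of the local ring at the centre along `A ≅ e(A) = A₀`
  let e' : A.toSubring ≃+* A₀.toSubring :=
    (A.toSubring.equivMapOfInjective (e : L →+* M) e.injective).trans
      (RingEquiv.subringCongr hmapS)
  have he' : ∀ a : A.toSubring, ((e' a : A₀.toSubring) : M) = e a := fun a => rfl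
  set P₀ : Ideal A₀.toSubring := Ideal.comap (Subring.inclusion hA₀O) (maximalIdeal O) with hP₀
  haveI hP₀p : P₀.IsPrime := Ideal.comap_isPrime _ _
  have hPe : P₀.comap (e' : A.toSubring →+* A₀.toSubring) =
      Ideal.comap (Subring.inclusion hA) (maximalIdeal (O.comap (e : L →+* M))) := by
    ext a
    have h2 : Subring.inclusion hA₀O (e' a) = ⟨e a, hA₀O (e' a).2⟩ := Subtype.ext (he' a)
    simp only [Ideal.mem_comap, hP₀, RingHom.coe_coe]
    rw [h2]
    exact (mk_mem_maximalIdeal_comap_iff O (e : L →+* M) (hA a.2)).symm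
  haveI : (P₀.comap (e' : A.toSubring →+* A₀.toSubring)).IsPrime := Ideal.comap_isPrime _ _
  exact (isRegularLocalRing_localization_iff_of_ringEquiv e' P₀).mpr
    (isRegularLocalRing_localization_atPrime_congr hPe.symm hreg)

/-! ## F-finite fields -/

/-- A field `k` is **F-finite** (for the exponent `p`; "`[k : k^p] < ∞`" in characteristic
`p`): finitely many elements generate `k` as a field together with the `p`-th powers `k^p`.
Perfect fields are F-finite (`FrobeniusFinite.of_perfectRing`), and so is every finitely generated
extension of an F-finite field (not needed here). [folklore] -/
def FrobeniusFinite (p : ℕ) (k : Type u) [Field k] : Prop :=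
  ∃ s : Finset k, Subfield.closure (Set.range (fun x : k => x ^ p) ∪ (s : Set k)) = ⊤

/-- Perfect fields (of exponent characteristic `p`) are F-finite: `k = k^p`. [folklore] -/
theorem FrobeniusFinite.of_perfectRing (p : ℕ) (k : Type u) [Field k] [ExpChar k p]
    [PerfectRing k p] : FrobeniusFinite p k := by
  refine ⟨∅, top_le_iff.mp fun x _ => Subfield.subset_closure (Or.inl ?_)⟩
  obtain ⟨y, hy⟩ := surjective_frobenius k p x
  exact ⟨y, by rw [← hy, frobenius_def]⟩

/-- F-finiteness is invariant under field isomorphisms. [folklore] -/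
theorem FrobeniusFinite.of_ringEquiv {p : ℕ} {k k' : Type u} [Field k] [Field k'] (e : k ≃+* k')
    (h : FrobeniusFinite p k) : FrobeniusFinite p k' := by
  classical
  obtain ⟨s, hs⟩ := h
  refine ⟨s.image e, top_le_iff.mp fun x _ => ?_⟩
  have hx : x ∈ Subfield.map (e : k →+* k') ⊤ := by
    rw [← RingHom.fieldRange_eq_map]
    exact RingHom.mem_fieldRange.mpr ⟨e.symm x, e.apply_symm_apply x⟩
  rw [← hs, RingHom.map_field_closure] at hx
  refine (Subfield.closure_mono ?_) hx
  rintro _ ⟨y, hy | hy, rfl⟩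
  · obtain ⟨z, rfl⟩ := hy
    exact Or.inl ⟨e z, by simp only [RingHom.coe_coe, map_pow]⟩
  · exact Or.inr (by rw [Finset.coe_image]; exact ⟨y, hy, rfl⟩)

/-- Iteration: if `k = k^p(s)` then `k = k^{p^n}(s)` for every `n`. [folklore] -/
theorem FrobeniusFinite.iterate {p : ℕ} {k : Type u} [Field k] [ExpChar k p]
    (h : FrobeniusFinite p k) (n : ℕ) :
    ∃ s : Finset k, Subfield.closure (Set.range (fun x : k => x ^ p ^ n) ∪ (s : Set k)) = ⊤ := by
  obtain ⟨s, hs⟩ := h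
  refine ⟨s, ?_⟩
  induction n with
  | zero =>
    exact top_le_iff.mp fun x _ => Subfield.subset_closure (Or.inl ⟨x, by simp⟩)
  | succ n ih =>
    -- `k^p ⊆ closure (k^{p^{n+1}} ∪ s)`: apply Frobenius to `k = closure (k^{p^n} ∪ s)`
    refine top_le_iff.mp (hs ▸ Subfield.closure_le.mpr ?_)
    rintro x (⟨y, rfl⟩ | hx)
    · -- `y ∈ closure (k^{p^n} ∪ s)`, so `y^p ∈ closure (k^{p^{n+1}} ∪ s^p) ⊆ closure (… ∪ s)`
      have hy : frobenius k p y ∈ Subfield.map (frobenius k p)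
          (Subfield.closure (Set.range (fun x : k => x ^ p ^ n) ∪ (s : Set k))) := by
        rw [ih]
        exact Subfield.mem_map.mpr ⟨y, Subfield.mem_top y, rfl⟩
      rw [RingHom.map_field_closure] at hy
      rw [show (fun x : k => x ^ p) y = frobenius k p y from (frobenius_def p y).symm]
      refine (Subfield.closure_le.mpr ?_) hy
      rintro _ ⟨z, hz | hz, rfl⟩
      · obtain ⟨w, rfl⟩ := hz
        refine Subfield.subset_closure (Or.inl ⟨w, ?_⟩)
        simp only [frobenius_def, ← pow_mul, pow_succ]
      · have hz' : z ∈ Subfield.closure (Set.range (fun x : k => x ^ p ^ (n + 1)) ∪ (s : Set k)) :=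
          Subfield.subset_closure (Or.inr hz)
        rw [frobenius_def]
        exact pow_mem hz' p
    · exact Subfield.subset_closure (Or.inr hx)

/-! ## Enlarging the ground field along an algebraic extension inside the valuation ring -/

open Literature.AlgebraicGeometry.CossartPiltant200819 in
/-- **Enlarging the ground field.** Let `k₀ ⊆ k ⊆ O ⊆ K` with `k` integral over the subfield
`k₀` of `K`. If `O` is locally uniformizable over `k₀` then it is locally uniformizable over `k`:
the regular local ring `R = A_𝔭 ⊆ K` of a `k₀`-model `A = k₀[g]` is normal with fraction field
`K`, hence contains `k`; so `R` is also the local ring of the `k`-model `k[g] ⊆ R` at the centre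
of `O`. (This is the step "`k^{p^n}`-models versus `k`-models" implicit in Temkin's Remark.)
[folklore] -/
theorem IsLocallyUniformizable.of_subfield_base {k K : Type u} [Field k] [Field K] [Algebra k K]
    (k₀ : Subfield K) (hk₀ : (k₀ : Set K) ⊆ Set.range (algebraMap k K))
    (halg : ∀ c : k, IsIntegral k₀ (algebraMap k K c)) (O : ValuationSubring K)
    (hk : ∀ c : k, algebraMap k K c ∈ O) (h : IsLocallyUniformizable (↥k₀) K O) :
    IsLocallyUniformizable k K O := by
  classical
  obtain ⟨R₀, ⟨A, ⟨g, hg⟩, hfrac, hAO, hR₀⟩, hreg⟩ := CP2008.exists_isLocalUniformizationOf O h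
  haveI := hfrac
  haveI : IsRegularLocalRing R₀ := hreg
  have hmemR₀ : ∀ x : K, x ∈ R₀ ↔ ∃ a ∈ A, ∃ s ∈ A, O.valuation s = 1 ∧ x = a * s⁻¹ :=
    fun x => by rw [← SetLike.mem_coe, hR₀]; rfl
  -- `A ⊆ R₀`
  have hAR₀ : ∀ a : K, a ∈ A → a ∈ R₀ := fun a ha =>
    (hmemR₀ a).mpr ⟨a, ha, 1, A.one_mem, by simp, by simp⟩
  -- `Frac R₀ = K`
  haveI hR₀fr : IsFractionRing R₀ K := by
    refine IsFractionRing.of_field R₀ K fun z => ?_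
    obtain ⟨a, b, -, rfl⟩ := IsFractionRing.div_surjective (A := A) z
    exact ⟨⟨a, hAR₀ a a.2⟩, ⟨b, hAR₀ b b.2⟩, rfl⟩
  -- `R₀` is integrally closed in `K` (regular ⇒ normal), so `k ⊆ R₀`
  have hkR₀ : ∀ c : k, algebraMap k K c ∈ R₀ := by
    intro c
    have hint : IsIntegral R₀ (algebraMap k K c) := (halg c).tower_top
    obtain ⟨y, hy⟩ :=
      (isIntegrallyClosed_iff K).mp (isIntegrallyClosed_of_isRegularLocalRing R₀) hint
    rw [← hy]
    exact y.2
  -- the `k`-model `A' = k[g]`, inside `O` and inside `R₀`, containing `A = k₀[g]`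
  let A' : Subalgebra k K := Algebra.adjoin k (g : Set K)
  have hA'fg : A'.FG := Subalgebra.fg_adjoin_finset g
  have hgA : (g : Set K) ⊆ (A : Set K) := by rw [← hg]; exact Algebra.subset_adjoin
  let Ok : Subalgebra k K := { O.toSubring with algebraMap_mem' := hk }
  have hA'O : A'.toSubring ≤ O.toSubring := by
    have h1 : A' ≤ Ok :=
      Algebra.adjoin_le fun x hx => (hAO (hgA hx : x ∈ A.toSubring) : x ∈ O.toSubring)
    exact fun x hx => h1 hx
  let R : Subalgebra k K :=
    { carrier := R₀
      mul_mem' := fun ha hb => R₀.mul_mem ha hb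
      one_mem' := R₀.one_mem
      add_mem' := fun ha hb => R₀.add_mem ha hb
      zero_mem' := R₀.zero_mem
      algebraMap_mem' := hkR₀ }
  have hA'R : A' ≤ R := Algebra.adjoin_le fun x hx => hAR₀ x (hgA hx)
  let A'₀ : Subalgebra k₀ K :=
    { carrier := A'
      mul_mem' := fun ha hb => A'.mul_mem ha hb
      one_mem' := A'.one_mem
      add_mem' := fun ha hb => A'.add_mem ha hb
      zero_mem' := A'.zero_mem
      algebraMap_mem' := fun c => by
        obtain ⟨d, hd⟩ := hk₀ c.2
        show (c : K) ∈ A'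
        rw [← hd]
        exact A'.algebraMap_mem d }
  have hAA' : ∀ x : K, x ∈ A → x ∈ A' := by
    have h1 : A ≤ A'₀ := by
      rw [← hg]
      exact Algebra.adjoin_le fun x hx => (Algebra.subset_adjoin hx : x ∈ A')
    exact fun x hx => h1 hx
  have hA'fr : IsFractionRing A' K := by
    refine IsFractionRing.of_field A' K fun z => ?_
    obtain ⟨a, b, -, rfl⟩ := IsFractionRing.div_surjective (A := A) z
    exact ⟨⟨a, hAA' a a.2⟩, ⟨b, hAA' b b.2⟩, rfl⟩
  -- `R = A'_{𝔭'}` inside `K`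
  have hR : (R : Set K) = {x | ∃ a ∈ A', ∃ s ∈ A', O.valuation s = 1 ∧ x = a * s⁻¹} := by
    ext x
    constructor
    · intro hx
      obtain ⟨a, ha, s, hs, hvs, rfl⟩ := (hmemR₀ x).mp hx
      exact ⟨a, hAA' a ha, s, hAA' s hs, hvs, rfl⟩
    · rintro ⟨a, ha, s, hs, hvs, rfl⟩
      obtain ⟨a₁, ha₁, s₁, hs₁, hv₁, rfl⟩ := (hmemR₀ a).mp (hA'R ha)
      obtain ⟨a₂, ha₂, s₂, hs₂, hv₂, rfl⟩ := (hmemR₀ s).mp (hA'R hs)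
      have hva₂ : O.valuation a₂ = 1 := by
        have h1 := hvs
        rwa [map_mul, map_inv₀, hv₂, inv_one, mul_one] at h1
      refine (hmemR₀ _).mpr ⟨a₁ * s₂, A.mul_mem ha₁ hs₂, s₁ * a₂, A.mul_mem hs₁ ha₂,
        by rw [map_mul, hv₁, hva₂, one_mul], ?_⟩
      simp only [mul_inv, inv_inv]
      ring
  -- `R ≅ R₀` is regular
  let eR : R₀ ≃+* R :=
    { toFun := fun x => ⟨x, x.2⟩
      invFun := fun y => ⟨y, y.2⟩
      left_inv := fun _ => rfl
      right_inv := fun _ => rfl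
      map_mul' := fun _ _ => rfl
      map_add' := fun _ _ => rfl }
  haveI : IsRegularLocalRing R := IsRegularLocalRing.of_ringEquiv eR
  exact CP2008.IsLocalUniformizationOf.isLocallyUniformizable O ⟨⟨A', hA'fg, hA'fr, hA'O, hR⟩, this⟩

/-! ## The remark over an F-finite ground field -/

section FFiniteBase

variable {p : ℕ} [hp : Fact p.Prime] {k K : Type u} [Field k] [CharP k p] [Field K] [Algebra k K]

variable (p k K) in
/-- The subfield `k^{p^n} ⊆ K` of `p^n`-th powers of (the image of) the ground field. [folklore] -/
def baseFrobImage (n : ℕ) : Subfield K :=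
  ((algebraMap k K).comp (iterateFrobenius k p n)).fieldRange

/-- Membership in `k^{p^n} ⊆ K`. [folklore] -/
theorem mem_baseFrobImage {n : ℕ} {x : K} :
    x ∈ baseFrobImage p k K n ↔ ∃ c : k, algebraMap k K c ^ p ^ n = x := by
  simp only [baseFrobImage, RingHom.mem_fieldRange, RingHom.comp_apply, iterateFrobenius_def,
    map_pow]

/-- The `n`-th Frobenius `k ≅ k^{p^n} ⊆ K`. [folklore] -/
def baseFrobImageEquiv (n : ℕ) : k ≃+* ↥(baseFrobImage p k K n) :=
  RingEquiv.ofBijective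
    (((algebraMap k K).comp (iterateFrobenius k p n)).codRestrict (baseFrobImage p k K n)
      fun c => RingHom.mem_fieldRange.mpr ⟨c, rfl⟩)
    ⟨fun a b h => ((algebraMap k K).comp (iterateFrobenius k p n)).injective
        (congrArg Subtype.val h :),
      fun x => by
        obtain ⟨c, hc⟩ := RingHom.mem_fieldRange.mp x.2
        exact ⟨c, Subtype.ext hc⟩⟩

/-- `baseFrobImageEquiv n c = c^{p^n}` in `K`. [folklore] -/
theorem coe_baseFrobImageEquiv (n : ℕ) (c : k) :
    ((baseFrobImageEquiv (p := p) (K := K) n c : baseFrobImage p k K n) : K) =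
      algebraMap k K c ^ p ^ n := by
  show ((algebraMap k K).comp (iterateFrobenius k p n)) c = _
  rw [RingHom.comp_apply, iterateFrobenius_def, map_pow]

/-- **Temkin 2013, Remark 1.3.5 (ii), one valuation at a time, over an F-finite ground field
(`[k : k^p] < ∞`).** Let `k` be F-finite of characteristic `p`, `K/k` finitely generated and
`O ⊇ k` a valuation ring of `K`; assume that for every `n` the `μ_p`-torsor steps inside `K` OVER
THE GROUND FIELD `k^{p^n}` ascend local uniformization at `O` (`MuPTorsorStepsAt p k^{p^n} O`).
Then `O` is locally uniformizable over `k`, granted inseparable local uniformization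
(`Temkin2013`). Proof as in the source: uniformize `L° ⊇ O` on Temkin's finite purely
inseparable `L/K` over `k`; the `n`-th Frobenius (`L^{p^n} ⊆ K`) is a field isomorphism
`L ≅ K₀ := L^{p^n} ⊆ K` over the isomorphism `k ≅ k^{p^n}` of ground fields, so `O ∩ K₀` is
uniformized OVER `k^{p^n}`; climb the finite purely inseparable tower
`K₀ ⊆ K₀(a₁^{1/p}) ⊆ … ⊆ K = K₀(generators of K/k, p-generators of k/k^{p^n})` (finite because
`k` is F-finite) by torsor steps over `k^{p^n}`; finally pass from the ground field `k^{p^n}` to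
`k` (`IsLocallyUniformizable.of_subfield_base`: `k` is integral over `k^{p^n}` and lies in `O`).
[cite: Temkin2013, Rem. 1.3.5 (ii) (arXiv:0804.1554v3 p. 4, Remark 1.5 (ii):
"Assume that [k:k^p] is finite. Then there exists a tower K = K_m ⊃ … ⊃ L^{p^n} = K_0 …")] -/
theorem isLocallyUniformizable_of_muPTorsorStepsAt_ffinite (hT : Temkin2013.{u})
    (hF : FrobeniusFinite p k) (hfg : (⊤ : IntermediateField k K).FG) (O : ValuationSubring K)
    (hk : ∀ c : k, algebraMap k K c ∈ O)
    (H : ∀ n : ℕ, MuPTorsorStepsAt p ↥(baseFrobImage p k K n) O) :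
    IsLocallyUniformizable k K O := by
  classical
  obtain ⟨L, _, _, _, _, hfin, hpi, O', hO', hLU⟩ := hT k K hfg O hk
  haveI := hfin
  haveI := hpi
  haveI : CharP K p := charP_of_injective_algebraMap (algebraMap k K).injective p
  haveI : ExpChar K p := ExpChar.prime hp.out
  -- `L^{p^n} ⊆ K`
  set n : ℕ := IsPurelyInseparable.exponent K L with hn
  let φ : L →+* K := IsPurelyInseparable.iterateFrobenius K L p le_rfl
  have hφL : ∀ x : L, algebraMap K L (φ x) = x ^ p ^ n := fun x =>
    IsPurelyInseparable.algebraMap_iterateFrobenius K p le_rfl x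
  have hφK : ∀ a : K, φ (algebraMap K L a) = a ^ p ^ n := fun a =>
    IsPurelyInseparable.iterateFrobenius_algebraMap L p le_rfl a
  have hφk : ∀ c : k, φ (algebraMap k L c) = algebraMap k K c ^ p ^ n := fun c => by
    rw [IsScalarTower.algebraMap_apply k K L, hφK]
  -- the ground field `k₀ = k^{p^n} ⊆ K` and `σ : k ≅ k₀`
  let k₀ : Subfield K := baseFrobImage p k K n
  let σ : k ≃+* k₀ := baseFrobImageEquiv n
  have hσ : ∀ c : k, ((σ c : k₀) : K) = algebraMap k K c ^ p ^ n := coe_baseFrobImageEquiv n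
  -- `F = L^{p^n}`, an intermediate field of `K / k₀`
  let F : IntermediateField k₀ K := φ.fieldRange.toIntermediateField fun c => by
    obtain ⟨d, hd⟩ := mem_baseFrobImage.mp c.2
    exact RingHom.mem_fieldRange.mpr ⟨algebraMap k L d, (hφk d).trans hd⟩
  have hmemF : ∀ x : K, x ∈ F ↔ ∃ y, φ y = x := fun x => RingHom.mem_fieldRange
  -- the Frobenius isomorphism `e : L ≅ F` over `σ`
  let φ₀ : L →+* F := φ.codRestrict F fun y => (hmemF _).mpr ⟨y, rfl⟩
  have hφ₀ : Function.Bijective φ₀ := by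
    refine ⟨fun a b h => φ.injective (congrArg Subtype.val h :), fun x => ?_⟩
    obtain ⟨y, hy⟩ := (hmemF x).mp x.2
    exact ⟨y, Subtype.ext hy⟩
  let e : L ≃+* F := RingEquiv.ofBijective φ₀ hφ₀
  have he_val : ∀ y : L, ((e y : F) : K) = φ y := fun y => rfl
  have he : ∀ c : k, e (algebraMap k L c) = algebraMap k₀ F (σ c) := fun c =>
    Subtype.ext (by rw [he_val, hφk]; exact (hσ c).symm)
  -- `e` carries `L° = O'` onto `O ∩ F`
  have hO'e : O' = (O.comap (algebraMap F K)).comap (e : L →+* F) := by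
    ext x
    show x ∈ O' ↔ φ x ∈ O
    rw [← hO', ValuationSubring.mem_comap, hφL]
    exact ⟨fun h => pow_mem h _,
      fun h => mem_valuationSubring_of_pow_mem O' (pow_pos hp.out.pos n) h⟩
  have hLU_F : IsLocallyUniformizable k₀ F (O.comap (algebraMap F K)) := by
    rw [hO'e] at hLU
    exact IsLocallyUniformizable.of_ringEquiv₂ e σ he _ hLU
  -- generators: `K = k(g)` and `k = k^{p^n}(s)`
  obtain ⟨g, hg⟩ := hfg
  obtain ⟨s, hs⟩ := hF.iterate n
  let t : Finset K := g ∪ s.image (algebraMap k K)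
  have ht : ∀ x ∈ t, x ^ p ^ n ∈ F := by
    intro x hx
    rcases Finset.mem_union.mp hx with hx | hx
    · exact (hmemF _).mpr ⟨algebraMap K L x, hφK x⟩
    · obtain ⟨c, -, rfl⟩ := Finset.mem_image.mp hx
      exact (hmemF _).mpr ⟨algebraMap k L c, hφk c⟩
  -- `F(t) = K`
  have htop' : F ⊔ IntermediateField.adjoin k₀ (t : Set K) = ⊤ := by
    refine top_le_iff.mp fun x _ => ?_
    have hx : x ∈ (IntermediateField.adjoin k (g : Set K)).toSubfield := by
      rw [hg]; trivial
    rw [IntermediateField.adjoin_toSubfield] at hx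
    have hsub : Set.range (algebraMap k K) ∪ (g : Set K) ⊆
        ((F ⊔ IntermediateField.adjoin k₀ (t : Set K)).toSubfield : Set K) := by
      rintro y (⟨c, rfl⟩ | hy)
      · have hc : algebraMap k K c ∈ Subfield.map (algebraMap k K)
            (Subfield.closure (Set.range (fun x : k => x ^ p ^ n) ∪ (s : Set k))) := by
          rw [hs]
          exact Subfield.mem_map.mpr ⟨c, Subfield.mem_top c, rfl⟩
        rw [RingHom.map_field_closure] at hc
        refine (Subfield.closure_le.mpr ?_) hc
        rintro _ ⟨d, hd | hd, rfl⟩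
        · obtain ⟨c', rfl⟩ := hd
          have h1 : algebraMap k K (c' ^ p ^ n) ∈ F := by
            rw [map_pow]
            exact (hmemF _).mpr ⟨algebraMap k L c', hφk c'⟩
          exact (le_sup_left : F ≤ F ⊔ IntermediateField.adjoin k₀ (t : Set K)) h1
        · refine (le_sup_right : IntermediateField.adjoin k₀ (t : Set K) ≤ _) ?_
          refine IntermediateField.subset_adjoin k₀ _ ?_
          rw [Finset.mem_coe]
          exact Finset.mem_union_right _ (Finset.mem_image_of_mem _ hd)
      · refine (le_sup_right : IntermediateField.adjoin k₀ (t : Set K) ≤ _) ?_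
        refine IntermediateField.subset_adjoin k₀ _ ?_
        rw [Finset.mem_coe]
        exact Finset.mem_union_left _ hy
    exact Subfield.closure_le.mpr hsub hx
  have htop := muPTorsor_tower_at O (H n) F n t ht hLU_F
  rw [htop'] at htop
  -- from `⊤ ≤ K` to `K`, over `k₀`
  have hLU₀ : IsLocallyUniformizable k₀ K O := by
    let e' : (⊤ : IntermediateField k₀ K) ≃+* K :=
      (IntermediateField.topEquiv (F := k₀) (E := K)).toRingEquiv
    have hcomap : O.comap (e' : (⊤ : IntermediateField k₀ K) →+* K) =
        O.comap (algebraMap (⊤ : IntermediateField k₀ K) K) := by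
      ext x; rfl
    refine IsLocallyUniformizable.of_ringEquiv e' (RingEquiv.refl k₀) (fun c => ?_) O ?_
    · exact (IntermediateField.topEquiv (F := k₀) (E := K)).commutes c
    · rw [hcomap]
      exact htop
  -- from the ground field `k₀ = k^{p^n}` to `k`
  refine IsLocallyUniformizable.of_subfield_base k₀ (fun x hx => ?_) (fun c => ?_) O hk hLU₀
  · obtain ⟨c, hc⟩ := mem_baseFrobImage.mp hx
    exact ⟨c ^ p ^ n, by rw [map_pow, hc]⟩
  · refine IsIntegral.of_pow (pow_pos hp.out.pos n) ?_
    rw [← hσ c]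
    exact isIntegral_algebraMap (R := ↥k₀) (A := K) (x := σ c)

end FFiniteBase

/-! ## Global forms -/

section Global

/-- **Local uniformization in characteristic `p` over F-finite ground fields**: Zariski local
uniformization (`IsLocallyUniformizable`) for every finitely generated `K/k` with `k` F-finite of
characteristic `p` and every valuation ring `O ⊇ k` of `K`. Sandwiched between
`LocalUniformizationInChar p` (all ground fields) and `LocalUniformizationPerfectInChar p`.
[folklore] -/
def LocalUniformizationFFiniteInChar (p : ℕ) : Prop :=
  ∀ (k K : Type u) [Field k] [CharP k p] [Field K] [Algebra k K], FrobeniusFinite p k →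
    (⊤ : IntermediateField k K).FG →
    ∀ O : ValuationSubring K, (∀ c : k, algebraMap k K c ∈ O) → IsLocallyUniformizable k K O

/-- **Temkin's `μ_p`-torsor problem over F-finite ground fields**: the torsor steps
`MuPTorsorStepsAt p k O` for every F-finite `k` of characteristic `p`, every `K/k` and every
valuation ring `O` of `K`. [cite: Temkin2013, Rem. 1.3.5 (ii)] -/
def MuPTorsorLocalUniformizationFFinite (p : ℕ) : Prop :=
  ∀ (k K : Type u) [Field k] [CharP k p] [Field K] [Algebra k K], FrobeniusFinite p k →
    ∀ O : ValuationSubring K, MuPTorsorStepsAt p k O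

/-- **Temkin's `μ_p`-torsor problem over arbitrary ground fields of characteristic `p`.**
[cite: Temkin2013, Rem. 1.3.5 (ii)] -/
def MuPTorsorLocalUniformizationInChar (p : ℕ) : Prop :=
  ∀ (k K : Type u) [Field k] [CharP k p] [Field K] [Algebra k K] (O : ValuationSubring K),
    MuPTorsorStepsAt p k O

/-- Restriction from all ground fields to F-finite ones. [folklore] -/
theorem LocalUniformizationInChar.ffinite {p : ℕ} (h : LocalUniformizationInChar.{u} p) :
    LocalUniformizationFFiniteInChar.{u} p :=
  fun k K _ _ _ _ _ hfg O hk => h k K hfg O hk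

/-- Restriction from F-finite ground fields to perfect ones. [folklore] -/
theorem LocalUniformizationFFiniteInChar.perfect {p : ℕ} [Fact p.Prime]
    (h : LocalUniformizationFFiniteInChar.{u} p) : LocalUniformizationPerfectInChar.{u} p :=
  fun k K _ _ _ _ _ hfg O hk => h k K (FrobeniusFinite.of_perfectRing p k) hfg O hk

/-- Restriction of the torsor problem from all ground fields to F-finite ones. [folklore] -/
theorem MuPTorsorLocalUniformizationInChar.ffinite {p : ℕ}
    (H : MuPTorsorLocalUniformizationInChar.{u} p) : MuPTorsorLocalUniformizationFFinite.{u} p :=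
  fun k K _ _ _ _ _ O => H k K O

/-- Restriction of the torsor problem from F-finite ground fields to perfect ones. [folklore] -/
theorem MuPTorsorLocalUniformizationFFinite.perfect {p : ℕ} [Fact p.Prime]
    (H : MuPTorsorLocalUniformizationFFinite.{u} p) : MuPTorsorLocalUniformization.{u} p :=
  fun k K _ _ _ _ _ O => H k K (FrobeniusFinite.of_perfectRing p k) O

/-- Local uniformization over F-finite fields trivially contains its `μ_p`-torsor case (apply it
to the finitely generated field `K₀(a)`). [folklore] -/
theorem LocalUniformizationFFiniteInChar.muPTorsorFFinite {p : ℕ}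
    (h : LocalUniformizationFFiniteInChar.{u} p) : MuPTorsorLocalUniformizationFFinite.{u} p := by
  intro k K _ _ _ _ hF O K₀ a _ hLU
  have hk : ∀ c : k, algebraMap k K c ∈ O := by
    obtain ⟨A, hA, -, -, -⟩ := hLU
    intro c
    have h1 : algebraMap K₀ K (algebraMap k K₀ c) ∈ O := hA (A.algebraMap_mem c)
    rwa [← IsScalarTower.algebraMap_apply] at h1
  have hK₀fg : K₀.FG := intermediateField_fg_of_fg_top K₀ hLU.fg_top
  have hMfg : (K₀ ⊔ IntermediateField.adjoin k {a}).FG :=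
    IntermediateField.fg_sup hK₀fg (by
      simpa using IntermediateField.fg_adjoin_finset (F := k) ({a} : Finset K))
  exact h k _ hF (intermediateField_fg_top_of_fg _ hMfg) _ fun c => by
    show algebraMap _ K (algebraMap k _ c) ∈ O
    rw [← IsScalarTower.algebraMap_apply]
    exact hk c

/-- The same over arbitrary ground fields. [folklore] -/
theorem LocalUniformizationInChar.muPTorsorInChar {p : ℕ} (h : LocalUniformizationInChar.{u} p) :
    MuPTorsorLocalUniformizationInChar.{u} p := by
  intro k K _ _ _ _ O K₀ a _ hLU
  have hk : ∀ c : k, algebraMap k K c ∈ O := by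
    obtain ⟨A, hA, -, -, -⟩ := hLU
    intro c
    have h1 : algebraMap K₀ K (algebraMap k K₀ c) ∈ O := hA (A.algebraMap_mem c)
    rwa [← IsScalarTower.algebraMap_apply] at h1
  have hK₀fg : K₀.FG := intermediateField_fg_of_fg_top K₀ hLU.fg_top
  have hMfg : (K₀ ⊔ IntermediateField.adjoin k {a}).FG :=
    IntermediateField.fg_sup hK₀fg (by
      simpa using IntermediateField.fg_adjoin_finset (F := k) ({a} : Finset K))
  exact h k _ (intermediateField_fg_top_of_fg _ hMfg) _ fun c => by
    show algebraMap _ K (algebraMap k _ c) ∈ O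
    rw [← IsScalarTower.algebraMap_apply]
    exact hk c

/-- **Temkin 2013, Remark 1.3.5 (ii) over F-finite ground fields (global form).** Granted
inseparable local uniformization, the `μ_p`-torsor problem over F-finite ground fields of
characteristic `p` implies local uniformization over every F-finite ground field of
characteristic `p`. [cite: Temkin2013, Rem. 1.3.5 (ii)] -/
theorem MuPTorsorLocalUniformizationFFinite.localUniformizationFFinite {p : ℕ} [Fact p.Prime]
    (hT : Temkin2013.{u}) (H : MuPTorsorLocalUniformizationFFinite.{u} p) :
    LocalUniformizationFFiniteInChar.{u} p := by
  intro k K _ _ _ _ hF hfg O hk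
  haveI : CharP K p := charP_of_injective_algebraMap (algebraMap k K).injective p
  exact isLocallyUniformizable_of_muPTorsorStepsAt_ffinite hT hF hfg O hk fun n =>
    H _ K (hF.of_ringEquiv (baseFrobImageEquiv n)) O

/-- **Temkin's reduction over F-finite ground fields, as an equivalence.** Granted inseparable
local uniformization (`Temkin2013`, a theorem in print), local uniformization in characteristic
`p` over F-finite ground fields is EQUIVALENT to its `μ_p`-torsor case over F-finite ground fields.
[cite: Temkin2013, Rem. 1.3.5 (ii)] -/
theorem localUniformizationFFiniteInChar_iff {p : ℕ} [Fact p.Prime] (hT : Temkin2013.{u}) :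
    LocalUniformizationFFiniteInChar.{u} p ↔ MuPTorsorLocalUniformizationFFinite.{u} p :=
  ⟨LocalUniformizationFFiniteInChar.muPTorsorFFinite, fun H => H.localUniformizationFFinite hT⟩

/-- In particular the torsor problem over ALL ground fields of characteristic `p` already gives
local uniformization over every F-finite ground field. [cite: Temkin2013, Rem. 1.3.5 (ii)] -/
theorem MuPTorsorLocalUniformizationInChar.localUniformizationFFinite {p : ℕ} [Fact p.Prime]
    (hT : Temkin2013.{u}) (H : MuPTorsorLocalUniformizationInChar.{u} p) :
    LocalUniformizationFFiniteInChar.{u} p :=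
  H.ffinite.localUniformizationFFinite hT

end Global


end Literature.AlgebraicGeometry.Resolution

end
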